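import Mathlib
import HarnessLib
import Literature.Combinatorics.Additive.StepBeyondKempermanFinite
import Literature.Combinatorics.Additive.StepBeyondKempermanSubcaseFour

/-!
# Grynkiewicz 2009, Theorem 4.1 (first part) for finite abelian groups — unconditional

[cite: Grynkiewicz2009, Thm 4.1; §6 CASE I (pp. 23–34)] [tag: critical-pair] [tag: inverse-theorem]

Topic `Literature/Combinatorics/Additive`.  Cell `mm-stpp` (D-0046), seat `mm-stpp-lit` (gen 25); the
port of D. J. Grynkiewicz, *A step beyond Kemperman's structure theorem*, Mathematika **55** (2009)
67–114, CASE I of the proof of Theorem 4.1 completed.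

**`Grynkiewicz2009.conclusion_of_finite` (Theorem 4.1, first part, `G` finite).**  Let `G` be a
finite abelian group and let `A, B ⊆ G` be nonempty with `|A + B| = |A| + |B|` and `A + B` aperiodic.
Then either there are `α, β ∈ G` with `|(A ∪ {α}) + (B ∪ {β})| = |A ∪ {α}| + |B ∪ {β}| − 1` (display
(17)), or there are a nontrivial subgroup `H ≤ G` and quasi-periodic decompositions `A = A₁ ∪ A₀`,
`B = B₁ ∪ B₀` with common quasi-period `H`, `A₀, B₀ ≠ ∅`, satisfying (i) `φ_H(A₀) + φ_H(B₀)` is a unique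
expression element in `φ_H(A) + φ_H(B)`, (ii) `|φ_H(A + B)| = |φ_H(A)| + |φ_H(B)| − 1`, (iii)
`|A + B| = |A| + |B|` … and `(A₀, B₀)` is of one of the types (V)–(VIII) (`IsGrynkiewiczDecomp`, the
tree's rendering of the printed conclusion, `StepBeyondKempermanTypes.lean`).

It is `conclusion_of_subcaseFour` (`StepBeyondKempermanFinite.lean`: Claims 1–11, Subcases 1–3, the
lexicographic induction over core pairs, stage 1 `conclusion_of_min_card_le_three`) with its one
hypothesis — Subcase 4 in the subgroups of `G` — supplied by `subcaseFour_false`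
(`StepBeyondKempermanSubcaseFour.lean`).  Also recorded: the same with the hypothesis «`A + B`
aperiodic» in the form `¬ IsPeriodic (A + B)` (`conclusion_of_finite'`).  The second part of Theorem 4.1
(`A + B` periodic) is `seventeen_or_isPeriodicWith_of_addStab` (`StepBeyondKempermanPeriodic.lean`).

WHAT THIS FILE IS NOT: CASE II (infinite `G`, by a Freiman isomorphism onto a finite group, print
pp. 34–36) is not here; Corollaries 4.2 (B)(C) and 4.3 as printed are not here; no new definitions, no
named facts.

## References
* D. J. Grynkiewicz, *A step beyond Kemperman's structure theorem*, Mathematika 55 (2009) 67–114,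
  doi:10.1112/S0025579300000966; Thm 4.1 (p. 10), §6 CASE I pp. 23–34 (held
  `paper:doi-10-1112-s0025579300000966`; arXiv:0710.1041) [cite: Grynkiewicz2009, Thm 4.1].
-/

namespace Literature.Combinatorics.Additive

open Finset
open scoped Pointwise

universe u

variable {G : Type u} [AddCommGroup G] [DecidableEq G]

namespace Grynkiewicz2009

/-- **Theorem 4.1 (first part) for finite `G`** — see the module docstring.
[cite: Grynkiewicz2009, Thm 4.1 (p. 10); proof §6 CASE I (pp. 23–34)] -/
theorem conclusion_of_finite [Fintype G] {A B : Finset G} (hA : A.Nonempty) (hB : B.Nonempty)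
    (hAB : #(A + B) = #A + #B) (haper : (A + B).addStab = {0}) :
    (∃ α β : G, #(insert α A + insert β B) + 1 = #(insert α A) + #(insert β B)) ∨
      ∃ (K : AddSubgroup G) (A₁ A₀ B₁ B₀ : Finset G), IsGrynkiewiczDecomp K A B A₁ A₀ B₁ B₀ :=
  conclusion_of_subcaseFour (fun _ _ => subcaseFour_false) hA hB hAB haper

/-- **Theorem 4.1 (first part) for finite `G`**, with «`A + B` aperiodic» spelled `¬ IsPeriodic`.
[cite: Grynkiewicz2009, Thm 4.1 (p. 10)] -/
theorem conclusion_of_finite' [Fintype G] {A B : Finset G} (hA : A.Nonempty) (hB : B.Nonempty)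
    (hAB : #(A + B) = #A + #B) (haper : ¬ IsPeriodic (A + B)) :
    (∃ α β : G, #(insert α A + insert β B) + 1 = #(insert α A) + #(insert β B)) ∨
      ∃ (K : AddSubgroup G) (A₁ A₀ B₁ B₀ : Finset G), IsGrynkiewiczDecomp K A B A₁ A₀ B₁ B₀ := by
  refine conclusion_of_finite hA hB hAB ?_
  by_contra h
  exact haper ((isPeriodic_iff_addStab_ne (hA.add hB)).2 h)

end Grynkiewicz2009

end Literature.Combinatorics.Additive
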